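import Mathlib
import Summits.ValiantsHypothesis.ValiantsHypothesis.Theorems.FifoMatchingNNLinearDegreeCofactorHardCondProbBits
import HarnessLib

/-!
# Crux `NNLinearDegreeCofactorHard` (stmt-ValiantsHypothesis-23918), line `internal_cofactor`: PASSAGE PRICING — the
# counting form of (D*-3) (LEAD-HANDOFF §p2) over free / forced / soft-forced coins

The passage dichotomy of the ∀c candidate μ* = `shedWord`: along a respecting word, every passage of a colour boundary through
the front is either a PASSED exhaustion gate (a past-designated coin takes its past-designated value; priced SOFTLY `2/3 : 1/3`
so that failing is allowed) or carries an injectively attributed TEST (a past-designated coin whose other value kills respect: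
priced `1 : 0`).  This file turns that bookkeeping into a bound on the number of words, over the single-coin supermartingale
`CondProbBits.sum_prod_condWeightBit_le_one`:

* `passageWeight` — the weight of coin `j` given a past-measurable KIND `κ j v ∈ {0 free, 1 forced, 2 soft}` and designated
  value `f j v`; `sum_passageWeight_setBit` (conditional probability), `passageWeight_eq_of_agree` (past-measurable);
* `prod_passageWeight_eq` — along a word taking the designated value at every forced coin, the product of the weights is
  `2^{-J} · 2^T · (4/3)^{G} · (2/3)^{F}` (`T` forced coins, `G` passed soft coins, `F` failed soft coins);
* `gain_ge` — `2^T (4/3)^G (2/3)^F ≥ (4/3)^P` whenever `F ≤ T` and `P ≤ T + G` (the attribution: every failed gate and every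
  gateless passage owns a distinct test);
* `card_mul_le_of_passages` — **hence `#A · (4/3)^P ≤ 2^J`** for every set `A` of words that take the designated value at
  their forced coins and satisfy the two attribution inequalities with `P` passages.

Honest framing: elementary counting; the deterministic attribution itself ((D*-1),(D*-2),(D*-4) over `ShedWordDefs`) is NOT
here; nothing here proves (D*), S2b, the crux or VP ≠ VNP.  Definitions: bookkeeping `bitAt`, `passageWeight`; no named facts.
-/

noncomputable section

-- Sub = Summit single-conjunct layout: the duplicated namespace component is mandated by the tree.
set_option linter.dupNamespace false

namespace Summit.ValiantsHypothesis.ValiantsHypothesis.Theorems.FifoMatching.NNLinearDegreeCofactorHard.CondProbBits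

open Finset

variable {J : ℕ}

/-- Coin `j` of `v` (junk `false` beyond the end). [folklore] -/
def bitAt (v : Fin J → Bool) (j : ℕ) : Bool := if h : j < J then v ⟨j, h⟩ else false

/-- **The passage weight** of coin `j`: free `1/2`; forced (`κ = 1`): `1` on the designated value `f`, `0` otherwise; soft
(`κ = 2`): `2/3` on `f`, `1/3` otherwise (any other kind value is treated as free). [folklore] -/
def passageWeight (κ : ℕ → (Fin J → Bool) → ℕ) (f : ℕ → (Fin J → Bool) → Bool) (j : ℕ) (v : Fin J → Bool) : ℝ :=
  if κ j v = 1 then (if bitAt v j = f j v then 1 else 0)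
  else if κ j v = 2 then (if bitAt v j = f j v then 2 / 3 else 1 / 3)
  else 1 / 2

variable (κ : ℕ → (Fin J → Bool) → ℕ) (f : ℕ → (Fin J → Bool) → Bool)

/-- Nonnegativity. [folklore] -/
theorem passageWeight_nonneg (j : ℕ) (v : Fin J → Bool) : 0 ≤ passageWeight κ f j v := by
  unfold passageWeight; split_ifs <;> norm_num

/-- **Past-measurability**: if the kind and the designated value of coin `j` depend on the bits `< j` only, the weight depends
on the bits `≤ j` only. [folklore] -/
theorem passageWeight_eq_of_agree
    (hκ : ∀ j (v w : Fin J → Bool), (∀ i : Fin J, i.val < j → v i = w i) → κ j v = κ j w ∧ f j v = f j w)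
    (j : ℕ) {v w : Fin J → Bool} (h : ∀ i : Fin J, i.val ≤ j → v i = w i) :
    passageWeight κ f j v = passageWeight κ f j w := by
  obtain ⟨hk, hf⟩ := hκ j v w (fun i hi => h i hi.le)
  have hb : bitAt v j = bitAt w j := by
    unfold bitAt
    split_ifs with hj
    · exact h _ le_rfl
    · rfl
  unfold passageWeight
  rw [hk, hf, hb]

/-- **Conditional probability**: over the two values of coin `j` the weights sum to exactly `1` (past-measurable kind/value).
[folklore] -/
theorem sum_passageWeight_setBit
    (hκ : ∀ j (v w : Fin J → Bool), (∀ i : Fin J, i.val < j → v i = w i) → κ j v = κ j w ∧ f j v = f j w)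
    (j : ℕ) (hj : j < J) (v : Fin J → Bool) :
    ∑ b : Bool, passageWeight κ f j (fun k : Fin J => if k.val = j then b else v k) = 1 := by
  set F : Bool → (Fin J → Bool) := fun b k => if k.val = j then b else v k with hF
  have hagree : ∀ b, ∀ i : Fin J, i.val < j → F b i = v i := by
    intro b i hi; simp only [hF]; rw [if_neg (by omega)]
  have hk : ∀ b, κ j (F b) = κ j v ∧ f j (F b) = f j v := fun b => hκ j (F b) v (hagree b)
  have hbit : ∀ b, bitAt (F b) j = b := by
    intro b
    unfold bitAt; rw [dif_pos hj]
    show (if (j = j) then b else v ⟨j, hj⟩) = b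
    rw [if_pos rfl]
  show ∑ b : Bool, passageWeight κ f j (F b) = 1
  have hrw : ∀ b, passageWeight κ f j (F b) =
      (if κ j v = 1 then (if b = f j v then 1 else 0)
       else if κ j v = 2 then (if b = f j v then 2 / 3 else 1 / 3) else 1 / 2 : ℝ) := by
    intro b; unfold passageWeight; rw [(hk b).1, (hk b).2, hbit b]
  simp only [hrw]
  by_cases h1 : κ j v = 1
  · simp only [if_pos h1]; exact sum_forcedWeight_eq _
  · simp only [if_neg h1]
    by_cases h2 : κ j v = 2
    · simp only [if_pos h2]; exact sum_softWeight_eq _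
    · simp only [if_neg h2]; simp

/-! ### The product along a word and the gain -/

/-- Along a word taking the designated value at every forced coin, the product of the passage weights is
`(1/2)^J · 2^T · (4/3)^G · (2/3)^F` with `T` = forced coins, `G` = passed soft coins, `F` = failed soft coins. [folklore] -/
theorem prod_passageWeight_eq (v : Fin J → Bool) (hforced : ∀ j < J, κ j v = 1 → bitAt v j = f j v) :
    ∏ j ∈ range J, passageWeight κ f j v
      = (1 / 2 : ℝ) ^ J * 2 ^ ((range J).filter fun j => κ j v = 1).card
        * (4 / 3 : ℝ) ^ ((range J).filter fun j => κ j v = 2 ∧ bitAt v j = f j v).card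
        * (2 / 3 : ℝ) ^ ((range J).filter fun j => κ j v = 2 ∧ bitAt v j ≠ f j v).card := by
  -- pointwise: weight = 1/2 · 2^[forced] · (4/3)^[soft ∧ pass] · (2/3)^[soft ∧ fail]
  have hpt : ∀ j ∈ range J, passageWeight κ f j v
      = (1 / 2 : ℝ) * (if κ j v = 1 then 2 else 1) * (if κ j v = 2 ∧ bitAt v j = f j v then 4 / 3 else 1)
        * (if κ j v = 2 ∧ bitAt v j ≠ f j v then 2 / 3 else 1) := by
    intro j hj
    rw [mem_range] at hj
    unfold passageWeight
    by_cases h1 : κ j v = 1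
    · rw [if_pos h1, if_pos (hforced j hj h1), if_pos h1,
        if_neg (by rintro ⟨h2, -⟩; omega), if_neg (by rintro ⟨h2, -⟩; omega)]
      norm_num
    · rw [if_neg h1, if_neg h1]
      by_cases h2 : κ j v = 2
      · rw [if_pos h2]
        by_cases hb : bitAt v j = f j v
        · rw [if_pos hb, if_pos ⟨h2, hb⟩, if_neg (fun h => h.2 hb)]; norm_num
        · rw [if_neg hb, if_neg (fun h => hb h.2), if_pos ⟨h2, hb⟩]; norm_num
      · rw [if_neg h2, if_neg (fun h => h2 h.1), if_neg (fun h => h2 h.1)]; norm_num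
  rw [prod_congr rfl hpt, prod_mul_distrib, prod_mul_distrib, prod_mul_distrib, prod_const, card_range,
    prod_ite, prod_ite, prod_ite]
  simp only [prod_const_one, mul_one, prod_const]

/-- **The gain inequality**: `2^T · (4/3)^G · (2/3)^F ≥ (4/3)^P` whenever every failed soft coin owns a test (`F ≤ T`) and
passed gates plus tests cover the passages (`P ≤ T + G`). [folklore] -/
theorem gain_ge (T G F P : ℕ) (hF : F ≤ T) (hP : P ≤ T + G) :
    (4 / 3 : ℝ) ^ P ≤ 2 ^ T * (4 / 3 : ℝ) ^ G * (2 / 3 : ℝ) ^ F := by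
  obtain ⟨d, rfl⟩ : ∃ d, T = F + d := ⟨T - F, by omega⟩
  -- `2^(F+d) (2/3)^F = (4/3)^F · 2^d ≥ (4/3)^F · (4/3)^d`
  have h1 : (2 : ℝ) ^ (F + d) * (2 / 3 : ℝ) ^ F = (4 / 3 : ℝ) ^ F * 2 ^ d := by
    rw [pow_add, mul_assoc, mul_comm ((2 : ℝ) ^ d), ← mul_assoc, ← mul_pow]; norm_num
  have h2 : (4 / 3 : ℝ) ^ d ≤ 2 ^ d := pow_le_pow_left₀ (by norm_num) (by norm_num) d
  calc (4 / 3 : ℝ) ^ P ≤ (4 / 3 : ℝ) ^ (F + d + G) := pow_le_pow_right₀ (by norm_num) (by omega)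
    _ = (4 / 3 : ℝ) ^ F * (4 / 3) ^ d * (4 / 3) ^ G := by rw [pow_add, pow_add]
    _ ≤ (4 / 3 : ℝ) ^ F * 2 ^ d * (4 / 3) ^ G := by gcongr
    _ = 2 ^ (F + d) * (4 / 3 : ℝ) ^ G * (2 / 3 : ℝ) ^ F := by rw [← h1]; ring

/-- **Passage pricing.**  Let the kinds `κ j v ∈ {1 forced, 2 soft, else free}` and designated values `f j v` depend on the bits
`< j` only.  If every word of `A` takes the designated value at each of its forced coins, and for every word of `A` the failed soft
coins number at most the forced coins (`F ≤ T`) and `P ≤ T + G` (`G` = passed soft coins), then `#A · (4/3)^P ≤ 2^J`.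
[folklore] -/
theorem card_mul_le_of_passages
    (hκ : ∀ j (v w : Fin J → Bool), (∀ i : Fin J, i.val < j → v i = w i) → κ j v = κ j w ∧ f j v = f j w)
    (A : Finset (Fin J → Bool)) (P : ℕ)
    (hforced : ∀ v ∈ A, ∀ j < J, κ j v = 1 → bitAt v j = f j v)
    (hF : ∀ v ∈ A, ((range J).filter fun j => κ j v = 2 ∧ bitAt v j ≠ f j v).card
      ≤ ((range J).filter fun j => κ j v = 1).card)
    (hP : ∀ v ∈ A, P ≤ ((range J).filter fun j => κ j v = 1).card
      + ((range J).filter fun j => κ j v = 2 ∧ bitAt v j = f j v).card) :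
    (A.card : ℝ) * (4 / 3 : ℝ) ^ P ≤ 2 ^ J := by
  have h2J : (0 : ℝ) < 2 ^ J := by positivity
  have key := card_mul_le_one_of_condWeightBit (passageWeight κ f) (passageWeight_nonneg κ f)
    (fun j v w h => passageWeight_eq_of_agree κ f hκ j h)
    (fun j hj v => (sum_passageWeight_setBit κ f hκ j hj v).le) A ((4 / 3 : ℝ) ^ P / 2 ^ J) ?_
  · rw [← mul_div_assoc, div_le_iff₀ h2J, one_mul] at key
    exact key
  · intro v hv
    rw [prod_passageWeight_eq κ f v (hforced v hv), div_eq_mul_inv, one_div, inv_pow, mul_comm ((4 / 3 : ℝ) ^ P)]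
    rw [mul_assoc, mul_assoc]
    refine mul_le_mul_of_nonneg_left ?_ (by positivity)
    rw [← mul_assoc]
    exact gain_ge _ _ _ _ (hF v hv) (hP v hv)

end Summit.ValiantsHypothesis.ValiantsHypothesis.Theorems.FifoMatching.NNLinearDegreeCofactorHard.CondProbBits

end
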